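import Summits.QuantumFields.YangMills.Theorems.BalabanUVNodesN15DerivDefectMajorant

/-!
# Route «BalabanUVNodes» (K4 «SpineRates»), node N15 = NE2, BACKGROUND LAYER — part 4: THE η-DEFECT OF A FIRST-ORDER
# PERTURBATION OPERATOR `V = M_c + Σ_μ M_{a_μ}∇_μ` SANDWICHED BETWEEN A FINE LEFT FACTOR AND A COARSE RIGHT FACTOR —
# both halves of NE2-LOCAL-A (coefficient: `T4EtaRateCoeffDefect`; derivative: parts 1–2) assembled by the Leibniz rule

Cell `pub-ymgap`, seat `pub-ymgap-dag-n15-b` (D-0062; `bears_on: R4∕N15`; `--supports stmt-QuantumFields-19351`).  THEOREMS ONLY.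
Record `pub-balaban/t4/T4-EST-U1a.md` §3 STEP 2 (NE2-LOCAL-A), verbatim: *«expand (3.50)–(3.53) p.400: "Δ_{U′U} = Δ_U − V′₁(A)" …
and invert by the Neumann series in the small first-order perturbation … each term is a product of U ≡ 1 local propagators (Step 1
rates) and multiplication operators built from A; the fine run uses A′ on the η′-bonds, the coarse run the field of Ū′ⁿ on the
η-bonds, and their pull-back discrepancy is ≤ (η-scale variation of A′) … a rate factor with γ = 1 at scale j»*.  The perturbation
`V₁(A)` of [Balaban1985BackgroundPropagators] (3.52)–(3.53) p. 400 is FIRST ORDER in the lattice derivatives with coefficients built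
from the background (MECHANISM; nothing of it is typed here): abstractly `V = M_c + Σ_{μ∈s} M_{a_μ} ∘ ∇_{η,μ}` on the coarse lattice and
`V′ = M_{c′} + Σ_{μ∈s} M_{a′_μ} ∘ ∇′_{η′,μ}` on the fine one.  By `T4EtaRateDefect.idef_comp`/`idef_add` its η-defect splits EXACTLY into
the coefficient defects `𝔇(M_{c′}, M_c)`, `𝔇(M_{a′_μ}, M_{a_μ}) ∘ ∇_μ` (the COEFFICIENT half — `T4EtaRateCoeffDefect`: fit error
`|a′ − a∘π| ≤ o ≤ ε·w`, one rate factor by its `rate_reading`) and the derivative defects `M_{a′_μ} ∘ 𝔇(∇′_μ, ∇_μ)` (the OPERATOR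
half — parts 1–2: small only inside composites, one factor `η′(M − 1) ≤ η`).  THIS FILE kernel-checks that split and the resulting
majorant of the SANDWICHED defect `T′ ∘ 𝔇(V′, V) ∘ A` — `T′` a fine left factor (in the Neumann series (3.64) `G′(U′U) = Σ (G′V′)ⁿG′`
the factor left of `V′` is the fine propagator), `A` a coarse right factor (the coarse propagator) — in the source-weighted
block-majorant currency `c·e^{−ρd(y,y′)}·w(y′)` of `T4EtaRateDefect.idef_neumann_majorant` (its `𝔇_K·A` source term).

CONTENTS ([folklore] bookkeeping over hypothesis-shaped data; `D : LineData X X′` one lattice direction with `Mη′ = η`).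
* §1 `idef_finset_sum` (the defect is additive over finite sums), `hasMaj_finset_sum`, `exp_rate_mono` (`e^{−(ρ+σ)d} ≤ e^{−ρd}`).
* §2 ONE DIRECTION: `idef_firstOrder_eq` (Leibniz: `𝔇(M_{a′}∇′, M_a∇) = M_{a′}∘𝔇(∇′,∇) + 𝔇(M_{a′},M_a)∘∇`), the sandwich identity
  `comp_idef_firstOrder_comp`, and the two pieces' majorants: `hasMaj_derivPiece` — from a weighted-row-bounded majorant `N₃`
  (`‖N₃‖_ρ ≤ m₃`) of the ADJOINT-DERIVATIVE ENTRY `(T′∘M_{a′}) ∘ ∇′*_{η′}` (SHAPE (3.42)₃ p. 397) and the coarse derivative entry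
  `∇_η ∘ A ≤ A₁e^{−ρd}` (SHAPE (3.42)₂): `m₃·|η′|(M−1)·A₁·e^{−ρd}`; `hasMaj_coeffPiece` — from `T′ ≤ N_T` (`‖N_T‖_ρ ≤ m_T`), the fit
  `o ≤ ε·w` and `∇_η ∘ A ≤ A₁e^{−(ρ+σ)d}`: `m_T·ε·A₁·C·e^{−ρd}·w(y′)` (`T4EtaRateCoeffDefect.hasMaj_idef_mulOp_comp_transfer` +
  `T4EtaRateDefect.hasMaj_comp_wrow_source`); and the SUM `hasMaj_comp_idef_firstOrder_comp` in the source-weighted form, the plain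
  factor `|η′|(M − 1)` being dominated by the weight through the one displayed inequality `|η′|(M − 1) ≤ c_η·w(y′)` (for the η-rate
  weight `w = T4EtaRateDefect.rateWeight g 1` = `L^{−j(y′)} ≥ L^{−k} = η` this holds with `c_η = 1`: the derivative half is AT LEAST as
  small as the coefficient half at every scale — (R1) of the record).
* §3 THE FULL FIRST-ORDER OPERATOR: `hasMaj_comp_idef_zerothOrder_comp` (the term `M_c`) and `hasMaj_comp_idef_sum_comp` (finite sums of
  sandwiched defects add their constants) — with §2 per direction this is the `𝔇_K·A`-type source term of
  `T4EtaRateDefect.idef_fix` for the step `K′ = T′V′`, `K = TV` modulo the term `𝔇(T′,T)·V·A` (the U ≡ 1 ∕ previous-order rate, a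
  binder of the node: NE2⁰, the -a seat's layer).

HONEST FRAMING ∕ LIMITS.  MECHANISM ONLY: every operator, coefficient, cube map, weight and majorant is a binder; (3.42)₂∕₃ and (3.52)–(3.53)
enter as SHAPES; the covariant derivative's own coefficient (`∇_U = ∇ +` multiplication by the bond variable) is one more coefficient
term of the same kind, not spelled out; no Neumann series is run here (that is `T4EtaRateDefect.idef_neumann_majorant`, whose `hDK`∕source
slot these majorants feed — S6 of the record, NOT attempted); nothing of [B6]∕[B9] asserted.  NE2⁺ NOT PRINTED, NOT proved; count-neutral;
one finite T⁴ at fixed ε — NOT infinite volume, NOT OS on ℝ⁴, NOT a mass gap, NOT Clay.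
-/

noncomputable section

namespace Summit.QuantumFields.YangMills.BalabanUVNodes.N15.DerivDefect

open Literature.MathematicalPhysics.QuantumFieldTheory.Balaban1983to89
open Literature.MathematicalPhysics.QuantumFieldTheory.Balaban1983to89.B11SectG (BlockNorm HasMaj hasMaj_comp hasMaj_zero)
open Literature.MathematicalPhysics.QuantumFieldTheory.Balaban1983to89.T4EtaRateDefect (idef idef_comp idef_add SlowWeight
  hasMaj_comp_wrow_source)
open Literature.MathematicalPhysics.QuantumFieldTheory.Balaban1983to89.T4EtaRateCoeffDefect (pull pull_apply diagK
  diagK_nonneg hasMaj_idef_mulOp_comp_transfer)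
open Literature.MathematicalPhysics.QuantumFieldTheory.Balaban1983to89.B9SectDWeightedNeumann (WRow hasMaj_comp_wrow)
open Literature.MathematicalPhysics.QuantumFieldTheory.Balaban1983to89.B6RandomWalk (Triangle254)
open Literature.MathematicalPhysics.QuantumFieldTheory.Balaban1983to89.B6Prop26Gluing (mulOp mulOp_apply)

/-! ## §1 Finite sums of defects and of majorants -/

section Sums

variable {F₁ F₂ F₁' F₂' : Type} [AddCommGroup F₁] [Module ℝ F₁] [AddCommGroup F₂] [Module ℝ F₂]
  [AddCommGroup F₁'] [Module ℝ F₁'] [AddCommGroup F₂'] [Module ℝ F₂']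

/-- The defect is ADDITIVE over finite sums of operators: `𝔇(Σ T′_i, Σ T_i) = Σ 𝔇(T′_i, T_i)`. [folklore] -/
theorem idef_finset_sum {ι : Type} (s : Finset ι) (τ₁ : F₁ →ₗ[ℝ] F₁') (τ₂ : F₂ →ₗ[ℝ] F₂')
    (T' : ι → F₁' →ₗ[ℝ] F₂') (T : ι → F₁ →ₗ[ℝ] F₂) :
    idef τ₁ τ₂ (∑ i ∈ s, T' i) (∑ i ∈ s, T i) = ∑ i ∈ s, idef τ₁ τ₂ (T' i) (T i) := by
  classical
  induction s using Finset.induction_on with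
  | empty => simp [idef]
  | insert i s hi ih => rw [Finset.sum_insert hi, Finset.sum_insert hi, Finset.sum_insert hi, idef_add, ih]

variable {g : B6.Geometry} {b₁ : BlockNorm g F₁} {b₂ : BlockNorm g F₂}

/-- Majorants ADD over finite sums of operators. [folklore] -/
theorem hasMaj_finset_sum {ι : Type} (s : Finset ι) {T : ι → F₁ →ₗ[ℝ] F₂} {K : ι → g.Site → g.Site → ℝ}
    (h : ∀ i ∈ s, HasMaj b₁ b₂ (T i) (K i)) :
    HasMaj b₁ b₂ (∑ i ∈ s, T i) (fun y y' => ∑ i ∈ s, K i y y') := by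
  classical
  induction s using Finset.induction_on with
  | empty =>
    simp only [Finset.sum_empty]
    exact hasMaj_zero b₁ b₂
  | insert i s hi ih =>
    have h' := (h i (Finset.mem_insert_self i s)).add (ih fun j hj => h j (Finset.mem_insert_of_mem hj))
    refine (h'.congr fun μ => ?_).mono fun y y' => le_of_eq ?_
    · rw [Finset.sum_insert hi]
    · rw [Finset.sum_insert hi]

/-- A better rate is a majorant at the worse rate: `e^{−(ρ+σ)d} ≤ e^{−ρd}` for `σ, d ≥ 0`. [folklore] -/
theorem exp_rate_mono {ρ σ t : ℝ} (hσ : 0 ≤ σ) (ht : 0 ≤ t) : Real.exp (-((ρ + σ) * t)) ≤ Real.exp (-(ρ * t)) :=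
  Real.exp_le_exp.mpr (by nlinarith)

end Sums

/-! ## §2 One direction: `V = M_a ∘ ∇_η`, `V′ = M_{a′} ∘ ∇′_{η′}` -/

section OneDirection

variable {X X' : Type} (D : LineData X X')

/-- LEIBNIZ: `𝔇(M_{a′}∇′_{η′}, M_a∇_η) = M_{a′} ∘ 𝔇(∇′_{η′}, ∇_η) + 𝔇(M_{a′}, M_a) ∘ ∇_η` — the derivative half and the coefficient half
of NE2-LOCAL-A (`T4EtaRateDefect.idef_comp` with all transports the pull-back). [folklore] -/
theorem idef_firstOrder_eq (a' : X' → ℝ) (a : X → ℝ) (η η' : ℝ) :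
    idef (pull D.π) (pull D.π) (mulOp a' ∘ₗ fdiffN η' D.s') (mulOp a ∘ₗ fdiffN η D.s) =
      mulOp a' ∘ₗ idef (pull D.π) (pull D.π) (fdiffN η' D.s') (fdiffN η D.s) +
        idef (pull D.π) (pull D.π) (mulOp a') (mulOp a) ∘ₗ fdiffN η D.s :=
  idef_comp (pull D.π) (pull D.π) (pull D.π) (mulOp a') (fdiffN η' D.s') (mulOp a) (fdiffN η D.s)

/-- THE SANDWICH IDENTITY: `T′ ∘ 𝔇(V′, V) ∘ A = (T′∘M_{a′}) ∘ 𝔇(∇′,∇) ∘ A + T′ ∘ (𝔇(M_{a′},M_a) ∘ (∇_η ∘ A))`. [folklore] -/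
theorem comp_idef_firstOrder_comp {F₁ F₃ : Type} [AddCommGroup F₁] [Module ℝ F₁] [AddCommGroup F₃] [Module ℝ F₃]
    (a' : X' → ℝ) (a : X → ℝ) (η η' : ℝ) (T' : (X' → ℝ) →ₗ[ℝ] F₃) (A : F₁ →ₗ[ℝ] (X → ℝ)) :
    T' ∘ₗ idef (pull D.π) (pull D.π) (mulOp a' ∘ₗ fdiffN η' D.s') (mulOp a ∘ₗ fdiffN η D.s) ∘ₗ A =
      (T' ∘ₗ mulOp a') ∘ₗ idef (pull D.π) (pull D.π) (fdiffN η' D.s') (fdiffN η D.s) ∘ₗ A +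
        T' ∘ₗ (idef (pull D.π) (pull D.π) (mulOp a') (mulOp a) ∘ₗ (fdiffN η D.s ∘ₗ A)) := by
  rw [idef_firstOrder_eq]
  ext v
  simp only [LinearMap.comp_apply, LinearMap.add_apply, map_add]

variable [Fintype X] [Fintype X'] {g : B6.Geometry} (blk : X → g.Site)
variable {F₁ F₃ : Type} [AddCommGroup F₁] [Module ℝ F₁] [AddCommGroup F₃] [Module ℝ F₃]
  {b₁ : BlockNorm g F₁} {b₃ : BlockNorm g F₃}

/-- THE DERIVATIVE PIECE in exponential currency: from `‖N₃‖_ρ ≤ m₃` for the adjoint-derivative entry of the fine left factor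
`(T′∘M_{a′}) ∘ ∇′*_{η′}` (SHAPE (3.42)₃) and `∇_η ∘ A ≤ A₁e^{−ρd}` (SHAPE (3.42)₂), the sandwiched derivative defect
`(T′∘M_{a′}) ∘ 𝔇(∇′_{η′}, ∇_η) ∘ A` has majorant `m₃·(|η′|(M−1)·A₁)·e^{−ρd(y,y′)}` (parts 1–2 + `hasMaj_comp_wrow`). [cite: Balaban1985BackgroundPropagators, Thm 3.1 (3.42) p.397 (entries 2, 3: shapes)] -/
theorem hasMaj_derivPiece {η η' : ℝ} (hη' : η' ≠ 0) (hMη : (D.M : ℝ) * η' = η) (htri : Triangle254 g) {ρ A₁ m₃ : ℝ}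
    (hρ : 0 ≤ ρ) (hA₁ : 0 ≤ A₁) {S' : (X' → ℝ) →ₗ[ℝ] F₃} {A : F₁ →ₗ[ℝ] (X → ℝ)} {N₃ : g.Site → g.Site → ℝ}
    (hN₃ : ∀ a b, 0 ≤ N₃ a b) (hm₃ : WRow g ρ N₃ m₃)
    (hS : HasMaj (BlockNorm.ofBlocks g (blk ∘ D.π)) b₃ (S' ∘ₗ bdiffN η' D.s') N₃)
    (hA : HasMaj b₁ (BlockNorm.ofBlocks g blk) (fdiffN η D.s ∘ₗ A) (fun y y' => A₁ * Real.exp (-(ρ * g.dist y y')))) :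
    HasMaj b₁ b₃ (S' ∘ₗ idef (pull D.π) (pull D.π) (fdiffN η' D.s') (fdiffN η D.s) ∘ₗ A)
      (fun y y' => m₃ * (|η'| * ((D.M : ℝ) - 1) * A₁) * Real.exp (-(ρ * g.dist y y'))) := by
  rw [comp_idef_fdiffN_comp D hη' hMη S' A]
  -- the scaled staircase after the coarse derivative entry: an exponential majorant with amplitude |η′|(M−1)A₁
  have hκ : (BlockNorm.ofBlocks g blk).κ = 1 := rfl
  have hmid : HasMaj b₁ (BlockNorm.ofBlocks g (blk ∘ D.π)) ((η' • D.stair) ∘ₗ (fdiffN η D.s ∘ₗ A))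
      (fun y y' => (|η'| * ((D.M : ℝ) - 1) * A₁) * Real.exp (-(ρ * g.dist y y'))) := by
    have key := hasMaj_comp (hasMaj_smul_stair D blk η') hA
      (diagK_nonneg fun _ => mul_nonneg (abs_nonneg _) (by linarith [D.one_le_M_real]))
    refine key.mono fun a b => le_of_eq ?_
    simp only [hκ, one_mul]
    rw [sum_diagK_mul]
    ring
  have key := hasMaj_comp_wrow htri hρ
    (mul_nonneg (mul_nonneg (abs_nonneg _) (by linarith [D.one_le_M_real])) hA₁) hN₃ hm₃ hS hmid
  have hκ' : (BlockNorm.ofBlocks g (blk ∘ D.π)).κ = 1 := rfl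
  simpa only [hκ', one_mul] using key

/-- THE COEFFICIENT PIECE (`T4EtaRateCoeffDefect` BY NAME): from `T′ ≤ N_T` (`‖N_T‖_ρ ≤ m_T`), the blockwise fit `|a′ − a∘π| ≤ o ≤ ε·w`
(slow weight `w`: tilt `σ`, constant `C`) and `∇_η ∘ A ≤ A₁e^{−(ρ+σ)d}`, the sandwiched coefficient defect
`T′ ∘ 𝔇(M_{a′}, M_a) ∘ (∇_η ∘ A)` has majorant `m_T·(εA₁C)·e^{−ρd(y,y′)}·w(y′)`. [folklore] -/
theorem hasMaj_coeffPiece {η : ℝ} (htri : Triangle254 g) (hdiag : ∀ y, g.dist y y = 0) {ρ σ C ε A₁ m_T : ℝ}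
    (hρ : 0 ≤ ρ) (hA₁ : 0 ≤ A₁) (hC : 0 ≤ C) (hε : 0 ≤ ε) {w o : g.Site → ℝ} (hw : ∀ y, 0 ≤ w y)
    (hsw : SlowWeight g σ C w) (ho : ∀ y, 0 ≤ o y) (how : ∀ y, o y ≤ ε * w y)
    {a' : X' → ℝ} {a : X → ℝ} (hfit : ∀ x', |a' x' - a (D.π x')| ≤ o (blk (D.π x')))
    {T' : (X' → ℝ) →ₗ[ℝ] F₃} {A : F₁ →ₗ[ℝ] (X → ℝ)} {N_T : g.Site → g.Site → ℝ} (hNT : ∀ a b, 0 ≤ N_T a b)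
    (hmT : WRow g ρ N_T m_T) (hT : HasMaj (BlockNorm.ofBlocks g (blk ∘ D.π)) b₃ T' N_T)
    (hA : HasMaj b₁ (BlockNorm.ofBlocks g blk) (fdiffN η D.s ∘ₗ A)
      (fun y y' => A₁ * Real.exp (-((ρ + σ) * g.dist y y')))) :
    HasMaj b₁ b₃ (T' ∘ₗ (idef (pull D.π) (pull D.π) (mulOp a') (mulOp a) ∘ₗ (fdiffN η D.s ∘ₗ A)))
      (fun y y' => m_T * (ε * A₁ * C) * Real.exp (-(ρ * g.dist y y')) * w y') := by
  have hin := hasMaj_idef_mulOp_comp_transfer (b₁ := b₁) blk D.π htri hdiag hρ hA₁ hC hε hw hsw ho how hfit hA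
  have key := hasMaj_comp_wrow_source htri hρ (mul_nonneg (mul_nonneg hε hA₁) hC) hNT hw hmT hT hin
  have hκ' : (BlockNorm.ofBlocks g (blk ∘ D.π)).κ = 1 := rfl
  simpa only [hκ', one_mul] using key

/-- **THE SANDWICHED FIRST-ORDER DEFECT, one direction.**  `T′ ∘ 𝔇(M_{a′}∇′_{η′}, M_a∇_η) ∘ A` has the source-weighted majorant
`(m₃A₁c_η + m_Tε A₁C)·e^{−ρd(y,y′)}·w(y′)` from: the adjoint-derivative entry of `T′∘M_{a′}` (`N₃`, `‖N₃‖_ρ ≤ m₃`), `T′` itself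
(`N_T`, `‖N_T‖_ρ ≤ m_T`), the coarse derivative entry `∇_η∘A ≤ A₁e^{−(ρ+σ)d}`, the coefficient fit `o ≤ ε·w`, and the domination of the
derivative half's plain factor by the weight, `|η′|(M − 1) ≤ c_η·w(y′)` (`c_η = 1` for the η-rate weight `L^{−j} ≥ η`, part 2
`abs_eta'_mul_pred_le`). [folklore] -/
theorem hasMaj_comp_idef_firstOrder_comp {η η' : ℝ} (hη' : η' ≠ 0) (hMη : (D.M : ℝ) * η' = η) (htri : Triangle254 g)
    (hd : ∀ a b : g.Site, 0 ≤ g.dist a b) (hdiag : ∀ y, g.dist y y = 0) {ρ σ C ε A₁ m_T m₃ cη : ℝ} (hρ : 0 ≤ ρ)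
    (hσ : 0 ≤ σ) (hA₁ : 0 ≤ A₁) (hC : 0 ≤ C) (hε : 0 ≤ ε) {w o : g.Site → ℝ} (hw : ∀ y, 0 ≤ w y) (hsw : SlowWeight g σ C w)
    (hηw : ∀ y', |η'| * ((D.M : ℝ) - 1) ≤ cη * w y') (ho : ∀ y, 0 ≤ o y) (how : ∀ y, o y ≤ ε * w y)
    {a' : X' → ℝ} {a : X → ℝ} (hfit : ∀ x', |a' x' - a (D.π x')| ≤ o (blk (D.π x')))
    {T' : (X' → ℝ) →ₗ[ℝ] F₃} {A : F₁ →ₗ[ℝ] (X → ℝ)} {N_T N₃ : g.Site → g.Site → ℝ}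
    (hNT : ∀ a b, 0 ≤ N_T a b) (hmT : WRow g ρ N_T m_T) (hT : HasMaj (BlockNorm.ofBlocks g (blk ∘ D.π)) b₃ T' N_T)
    (hN₃ : ∀ a b, 0 ≤ N₃ a b) (hm₃ : WRow g ρ N₃ m₃)
    (hS : HasMaj (BlockNorm.ofBlocks g (blk ∘ D.π)) b₃ ((T' ∘ₗ mulOp a') ∘ₗ bdiffN η' D.s') N₃)
    (hA : HasMaj b₁ (BlockNorm.ofBlocks g blk) (fdiffN η D.s ∘ₗ A)
      (fun y y' => A₁ * Real.exp (-((ρ + σ) * g.dist y y')))) :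
    HasMaj b₁ b₃ (T' ∘ₗ idef (pull D.π) (pull D.π) (mulOp a' ∘ₗ fdiffN η' D.s') (mulOp a ∘ₗ fdiffN η D.s) ∘ₗ A)
      (fun y y' => (m₃ * A₁ * cη + m_T * (ε * A₁ * C)) * Real.exp (-(ρ * g.dist y y')) * w y') := by
  rw [comp_idef_firstOrder_comp D]
  have hAρ : HasMaj b₁ (BlockNorm.ofBlocks g blk) (fdiffN η D.s ∘ₗ A)
      (fun y y' => A₁ * Real.exp (-(ρ * g.dist y y'))) :=
    hA.mono fun y y' => mul_le_mul_of_nonneg_left (exp_rate_mono hσ (hd y y')) hA₁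
  have h1 := hasMaj_derivPiece D blk hη' hMη htri hρ hA₁ hN₃ hm₃ hS hAρ
  have h2 := hasMaj_coeffPiece D blk htri hdiag hρ hA₁ hC hε hw hsw ho how hfit hNT hmT hT hA
  refine (h1.add h2).mono fun y y' => ?_
  have hm₃0 : 0 ≤ m₃ := hm₃.nonneg hN₃ y
  have hE : 0 ≤ Real.exp (-(ρ * g.dist y y')) := Real.exp_nonneg _
  have hder : m₃ * (|η'| * ((D.M : ℝ) - 1) * A₁) * Real.exp (-(ρ * g.dist y y')) ≤
      m₃ * A₁ * cη * Real.exp (-(ρ * g.dist y y')) * w y' := by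
    have := hηw y'
    calc m₃ * (|η'| * ((D.M : ℝ) - 1) * A₁) * Real.exp (-(ρ * g.dist y y'))
        = (m₃ * A₁ * Real.exp (-(ρ * g.dist y y'))) * (|η'| * ((D.M : ℝ) - 1)) := by ring
      _ ≤ (m₃ * A₁ * Real.exp (-(ρ * g.dist y y'))) * (cη * w y') :=
          mul_le_mul_of_nonneg_left this (mul_nonneg (mul_nonneg hm₃0 hA₁) hE)
      _ = m₃ * A₁ * cη * Real.exp (-(ρ * g.dist y y')) * w y' := by ring
  calc m₃ * (|η'| * ((D.M : ℝ) - 1) * A₁) * Real.exp (-(ρ * g.dist y y')) +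
        m_T * (ε * A₁ * C) * Real.exp (-(ρ * g.dist y y')) * w y'
      ≤ m₃ * A₁ * cη * Real.exp (-(ρ * g.dist y y')) * w y' +
        m_T * (ε * A₁ * C) * Real.exp (-(ρ * g.dist y y')) * w y' := add_le_add hder le_rfl
    _ = (m₃ * A₁ * cη + m_T * (ε * A₁ * C)) * Real.exp (-(ρ * g.dist y y')) * w y' := by ring

end OneDirection

/-! ## §3 The full first-order operator: the zeroth-order term and finite sums over directions -/

section Full

variable {X X' : Type} [Fintype X] [Fintype X'] {g : B6.Geometry} (blk : X → g.Site) (π : X' → X)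
variable {F₁ F₃ : Type} [AddCommGroup F₁] [Module ℝ F₁] [AddCommGroup F₃] [Module ℝ F₃]
  {b₁ : BlockNorm g F₁} {b₃ : BlockNorm g F₃}

/-- THE ZEROTH-ORDER TERM `M_c` sandwiched: `T′ ∘ 𝔇(M_{c′}, M_c) ∘ A ≤ m_T·(ε₀A₀C)·e^{−ρd}·w(y′)` from the fit `|c′ − c∘π| ≤ o₀ ≤ ε₀·w`,
`T′ ≤ N_T` (`‖N_T‖_ρ ≤ m_T`) and `A ≤ A₀e^{−(ρ+σ)d}` (`T4EtaRateCoeffDefect.hasMaj_idef_mulOp_comp_transfer` + `hasMaj_comp_wrow_source`).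
[folklore] -/
theorem hasMaj_comp_idef_zerothOrder_comp (htri : Triangle254 g) (hdiag : ∀ y, g.dist y y = 0) {ρ σ C ε₀ A₀ m_T : ℝ}
    (hρ : 0 ≤ ρ) (hA₀ : 0 ≤ A₀) (hC : 0 ≤ C) (hε₀ : 0 ≤ ε₀) {w o₀ : g.Site → ℝ} (hw : ∀ y, 0 ≤ w y)
    (hsw : SlowWeight g σ C w) (ho₀ : ∀ y, 0 ≤ o₀ y) (how₀ : ∀ y, o₀ y ≤ ε₀ * w y)
    {c' : X' → ℝ} {c : X → ℝ} (hfit : ∀ x', |c' x' - c (π x')| ≤ o₀ (blk (π x')))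
    {T' : (X' → ℝ) →ₗ[ℝ] F₃} {A : F₁ →ₗ[ℝ] (X → ℝ)} {N_T : g.Site → g.Site → ℝ} (hNT : ∀ a b, 0 ≤ N_T a b)
    (hmT : WRow g ρ N_T m_T) (hT : HasMaj (BlockNorm.ofBlocks g (blk ∘ π)) b₃ T' N_T)
    (hA : HasMaj b₁ (BlockNorm.ofBlocks g blk) A (fun y y' => A₀ * Real.exp (-((ρ + σ) * g.dist y y')))) :
    HasMaj b₁ b₃ (T' ∘ₗ idef (pull π) (pull π) (mulOp c') (mulOp c) ∘ₗ A)
      (fun y y' => m_T * (ε₀ * A₀ * C) * Real.exp (-(ρ * g.dist y y')) * w y') := by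
  have hin := hasMaj_idef_mulOp_comp_transfer (b₁ := b₁) blk π htri hdiag hρ hA₀ hC hε₀ hw hsw ho₀ how₀ hfit hA
  have key := hasMaj_comp_wrow_source htri hρ (mul_nonneg (mul_nonneg hε₀ hA₀) hC) hNT hw hmT hT hin
  have hκ' : (BlockNorm.ofBlocks g (blk ∘ π)).κ = 1 := rfl
  have hop : T' ∘ₗ idef (pull π) (pull π) (mulOp c') (mulOp c) ∘ₗ A =
      T' ∘ₗ (idef (pull π) (pull π) (mulOp c') (mulOp c) ∘ₗ A) := rfl
  rw [hop]
  simpa only [hκ', one_mul] using key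

variable {F₁' F₃' : Type} [AddCommGroup F₁'] [Module ℝ F₁'] [AddCommGroup F₃'] [Module ℝ F₃']

omit [Fintype X'] in
/-- FINITE SUMS OF SANDWICHED DEFECTS: if each summand `T′ ∘ 𝔇(V′_i, V_i) ∘ A` has a source-weighted majorant
`c_i·e^{−ρd}·w(y′)`, the defect of the sums has `(Σ c_i)·e^{−ρd}·w(y′)` — with §2 per direction and the zeroth-order term, the
η-defect of the full first-order perturbation `V = M_c + Σ_μ M_{a_μ}∇_μ`, sandwiched, is source-weighted with ONE rate factor in
every constant. [folklore] -/
theorem hasMaj_comp_idef_sum_comp {ι : Type} (s : Finset ι) {τ₁ : F₁' →ₗ[ℝ] (X' → ℝ)} {τ₂ : F₃' →ₗ[ℝ] (X' → ℝ)}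
    {V' : ι → (X' → ℝ) →ₗ[ℝ] (X' → ℝ)} {V : ι → F₁' →ₗ[ℝ] F₃'} {T' : (X' → ℝ) →ₗ[ℝ] F₃} {A : F₁ →ₗ[ℝ] F₁'}
    {c : ι → ℝ} {ρ : ℝ} {w : g.Site → ℝ}
    (h : ∀ i ∈ s, HasMaj b₁ b₃ (T' ∘ₗ idef τ₁ τ₂ (V' i) (V i) ∘ₗ A)
      (fun y y' => c i * Real.exp (-(ρ * g.dist y y')) * w y')) :
    HasMaj b₁ b₃ (T' ∘ₗ idef τ₁ τ₂ (∑ i ∈ s, V' i) (∑ i ∈ s, V i) ∘ₗ A)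
      (fun y y' => (∑ i ∈ s, c i) * Real.exp (-(ρ * g.dist y y')) * w y') := by
  have hsum := hasMaj_finset_sum s h
  have hop : T' ∘ₗ idef τ₁ τ₂ (∑ i ∈ s, V' i) (∑ i ∈ s, V i) ∘ₗ A =
      ∑ i ∈ s, T' ∘ₗ idef τ₁ τ₂ (V' i) (V i) ∘ₗ A := by
    rw [idef_finset_sum]
    ext v
    simp only [LinearMap.comp_apply, LinearMap.coe_sum, Finset.sum_apply, map_sum]
  rw [hop]
  refine hsum.mono fun y y' => le_of_eq ?_
  rw [Finset.sum_mul, Finset.sum_mul]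

end Full

end Summit.QuantumFields.YangMills.BalabanUVNodes.N15.DerivDefect
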